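import Summits.CriticalPhenomena.PercolationContinuityZ3.Theorems.PercNearOneGluingNoHeavyLowerTailSunflowerXChainOnePetal
import Summits.CriticalPhenomena.PercolationContinuityZ3.Theorems.PercNearOneGluingNoHeavyLowerTailSunflowerPowerCertificate

/-!
# THE X-CHAIN CERTIFICATE THEOREM: (RES0′) for EVERY number of petals from the cell budgets y,k,h and the Ȳ-face budget

(prove-1 gen 56, memo run/shared/lean/prim/prim-ineq-prove-1/FINDING-CHAIN-prove1-g56.md §3(B).)  Companion of `res0_of_chain_certificate`:
exponents `λ_y, λ_k, λ_h, λ_X ≥ 0` satisfying the three chain equations with x-factors (h-petal, H-hub, full petal) and the three kink-dwarf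
inequalities (Da), (Db), (Dc) with x-factors, constant `c₀ ≥ τσ + (1−τ)(1−s)α₀₀`; conclusion: every nonempty family of petals obeying
`∏y ≤ α₀₀^(n−1)`, `∏k ≤ α₀₁^(n−1)`, `∏h ≤ α₁₁^(n−1)`, `∏Ȳ ≤ b_Ȳ^(n−1)` satisfies `∏ G_j ≤ g^(n−1)·a`.  (`xchain_one_petal_of` +
`prod_le_of_power_certificate`.)  The exact 14-vertex criterion for such certificates holds at ≈ 88 % of random parameter points; together with
the cell chain (`…SunflowerChainOnePetal`) ≈ 91 %, and with the analogous H-face chain ≈ 95 % (memo §3). [this work]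
-/

namespace Summit.CriticalPhenomena.PercolationContinuityZ3.Theorems.SunflowerPartition.SafeCalc.LinkedCurrency

open Finset

set_option maxHeartbeats 800000 in
/-- **(RES0′) for every number of petals from the X-chain certificate** (see the module docstring). [this work] -/
theorem res0_of_xchain_certificate {κ : Type*} [DecidableEq κ] {τ σ s α00 α01 α11 c0 ly lk lh lX : ℝ} (hτ0 : 0 < τ) (hτ1 : τ < 1)
    (hσ0 : 0 ≤ σ) (hσ1 : σ < 1) (hs0 : 0 < s) (hs1 : s < 1) (hα00 : 0 < α00) (h01 : α00 ≤ α01) (h11 : α01 ≤ α11) (hα1 : α11 ≤ 1)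
    (hc0 : τ * σ + (1 - τ) * (1 - s) * α00 ≤ c0) (hly : 0 ≤ ly) (hlk : 0 ≤ lk) (hlh : 0 ≤ lh) (hlX : 0 ≤ lX)
    (Eh : (c0 + τ * (1 - σ) * ((1 - s) * α00 + s * α01) + s * (1 - τ) * ((1 - σ) * α01 + σ * 1)) = (c0 + τ * (1 - σ) * ((1 - s) * α00 + s * α01) + s * (1 - τ) * ((1 - σ) * α01 + σ * α11)) * (1 / α11) ^ lh)
    (EH : (c0 + τ * (1 - σ) * ((1 - s) * α00 + s * 1) + s * (1 - τ) * ((1 - σ) * 1 + σ * 1)) = (c0 + τ * (1 - σ) * ((1 - s) * α00 + s * α01) + s * (1 - τ) * ((1 - σ) * α01 + σ * α11)) * (1 / α01) ^ lk * (1 / α11) ^ lh * (((1 - s) * α00 + s * 1) / ((1 - s) * α00 + s * α01)) ^ lX)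
    (Ef : (c0 + τ * (1 - σ) * ((1 - s) * 1 + s * 1) + s * (1 - τ) * ((1 - σ) * 1 + σ * 1)) = (c0 + τ * (1 - σ) * ((1 - s) * α00 + s * α01) + s * (1 - τ) * ((1 - σ) * α01 + σ * α11)) * (1 / α00) ^ ly * (1 / α01) ^ lk * (1 / α11) ^ lh * (1 / ((1 - s) * α00 + s * α01)) ^ lX)
    (Da : (c0 + τ * (1 - σ) * ((1 - s) * α01 + s * α01) + s * (1 - τ) * ((1 - σ) * α01 + σ * α11)) ≤ (c0 + τ * (1 - σ) * ((1 - s) * α00 + s * α01) + s * (1 - τ) * ((1 - σ) * α01 + σ * α11)) * (α01 / α00) ^ ly * (α01 / ((1 - s) * α00 + s * α01)) ^ lX)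
    (Db : (c0 + τ * (1 - σ) * ((1 - s) * α00 + s * α11) + s * (1 - τ) * ((1 - σ) * α11 + σ * α11)) ≤ (c0 + τ * (1 - σ) * ((1 - s) * α00 + s * α01) + s * (1 - τ) * ((1 - σ) * α01 + σ * α11)) * (α11 / α01) ^ lk * (((1 - s) * α00 + s * α11) / ((1 - s) * α00 + s * α01)) ^ lX)
    (Dc : (c0 + τ * (1 - σ) * ((1 - s) * α11 + s * α11) + s * (1 - τ) * ((1 - σ) * α11 + σ * α11)) ≤ (c0 + τ * (1 - σ) * ((1 - s) * α00 + s * α01) + s * (1 - τ) * ((1 - σ) * α01 + σ * α11)) * (α11 / α00) ^ ly * (α11 / α01) ^ lk * (α11 / ((1 - s) * α00 + s * α01)) ^ lX)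
    (S : Finset κ) (hS : S.Nonempty) (y k gc h : κ → ℝ)
    (hy : ∀ j ∈ S, α00 ≤ y j) (hyk : ∀ j ∈ S, y j ≤ k j) (hk1 : ∀ j ∈ S, k j ≤ 1) (hg : ∀ j ∈ S, α01 ≤ gc j)
    (hgk : ∀ j ∈ S, gc j ≤ k j) (hgh : ∀ j ∈ S, gc j ≤ h j) (hh : ∀ j ∈ S, α11 ≤ h j) (hh1 : ∀ j ∈ S, h j ≤ 1)
    (hBy : ∏ j ∈ S, y j ≤ α00 ^ (S.card - 1)) (hBk : ∏ j ∈ S, k j ≤ α01 ^ (S.card - 1)) (hBh : ∏ j ∈ S, h j ≤ α11 ^ (S.card - 1))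
    (hBY : ∏ j ∈ S, ((1 - s) * y j + s * k j) ≤ ((1 - s) * α00 + s * α01) ^ (S.card - 1)) :
    ∏ j ∈ S, (c0 + τ * (1 - σ) * ((1 - s) * y j + s * k j) + s * (1 - τ) * ((1 - σ) * gc j + σ * h j)) ≤ (c0 + τ * (1 - σ) * ((1 - s) * α00 + s * α01) + s * (1 - τ) * ((1 - σ) * α01 + σ * α11)) ^ (S.card - 1) * (c0 + τ * (1 - σ) * ((1 - s) * 1 + s * 1) + s * (1 - τ) * ((1 - σ) * 1 + σ * 1)) := by
  have hα01 : 0 < α01 := lt_of_lt_of_le hα00 h01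
  have hα11 : 0 < α11 := lt_of_lt_of_le hα01 h11
  have hH : 0 < τ ∧ τ < 1 ∧ 0 ≤ σ ∧ σ < 1 ∧ 0 < s ∧ s < 1 ∧ 0 < α00 ∧ α00 ≤ α01 ∧ α01 ≤ α11 ∧ α11 ≤ 1 ∧
      τ * σ + (1 - τ) * (1 - s) * α00 ≤ c0 ∧ 0 ≤ ly ∧ 0 ≤ lk ∧ 0 ≤ lh ∧ 0 ≤ lX ∧
      (c0 + τ * (1 - σ) * ((1 - s) * α00 + s * α01) + s * (1 - τ) * ((1 - σ) * α01 + σ * α11)) = (c0 + τ * (1 - σ) * ((1 - s) * α00 + s * α01) + s * (1 - τ) * ((1 - σ) * α01 + σ * α11)) ∧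
      (c0 + τ * (1 - σ) * ((1 - s) * α00 + s * α01) + s * (1 - τ) * ((1 - σ) * α01 + σ * 1)) = (c0 + τ * (1 - σ) * ((1 - s) * α00 + s * α01) + s * (1 - τ) * ((1 - σ) * α01 + σ * α11)) * (1 / α11) ^ lh ∧
      (c0 + τ * (1 - σ) * ((1 - s) * α00 + s * 1) + s * (1 - τ) * ((1 - σ) * 1 + σ * 1)) = (c0 + τ * (1 - σ) * ((1 - s) * α00 + s * α01) + s * (1 - τ) * ((1 - σ) * α01 + σ * α11)) * (1 / α01) ^ lk * (1 / α11) ^ lh * (((1 - s) * α00 + s * 1) / ((1 - s) * α00 + s * α01)) ^ lX ∧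
      (c0 + τ * (1 - σ) * ((1 - s) * 1 + s * 1) + s * (1 - τ) * ((1 - σ) * 1 + σ * 1)) = (c0 + τ * (1 - σ) * ((1 - s) * α00 + s * α01) + s * (1 - τ) * ((1 - σ) * α01 + σ * α11)) * (1 / α00) ^ ly * (1 / α01) ^ lk * (1 / α11) ^ lh * (1 / ((1 - s) * α00 + s * α01)) ^ lX ∧
      (c0 + τ * (1 - σ) * ((1 - s) * α01 + s * α01) + s * (1 - τ) * ((1 - σ) * α01 + σ * α11)) ≤ (c0 + τ * (1 - σ) * ((1 - s) * α00 + s * α01) + s * (1 - τ) * ((1 - σ) * α01 + σ * α11)) * (α01 / α00) ^ ly * (α01 / ((1 - s) * α00 + s * α01)) ^ lX ∧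
      (c0 + τ * (1 - σ) * ((1 - s) * α00 + s * α11) + s * (1 - τ) * ((1 - σ) * α11 + σ * α11)) ≤ (c0 + τ * (1 - σ) * ((1 - s) * α00 + s * α01) + s * (1 - τ) * ((1 - σ) * α01 + σ * α11)) * (α11 / α01) ^ lk * (((1 - s) * α00 + s * α11) / ((1 - s) * α00 + s * α01)) ^ lX ∧
      (c0 + τ * (1 - σ) * ((1 - s) * α11 + s * α11) + s * (1 - τ) * ((1 - σ) * α11 + σ * α11)) ≤ (c0 + τ * (1 - σ) * ((1 - s) * α00 + s * α01) + s * (1 - τ) * ((1 - σ) * α01 + σ * α11)) * (α11 / α00) ^ ly * (α11 / α01) ^ lk * (α11 / ((1 - s) * α00 + s * α01)) ^ lX :=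
    ⟨hτ0, hτ1, hσ0, hσ1, hs0, hs1, hα00, h01, h11, hα1, hc0, hly, hlk, hlh, hlX, rfl, Eh, EH, Ef, Da, Db, Dc⟩
  have hbas := xchain_basic hH
  have hg0 : 0 < (c0 + τ * (1 - σ) * ((1 - s) * α00 + s * α01) + s * (1 - τ) * ((1 - σ) * α01 + σ * α11)) := hbas.1
  have hbY0 : 0 < ((1 - s) * α00 + s * α01) := hbas.2.1
  obtain ⟨g, hgdef⟩ : ∃ t : ℝ, t = (c0 + τ * (1 - σ) * ((1 - s) * α00 + s * α01) + s * (1 - τ) * ((1 - σ) * α01 + σ * α11)) := ⟨_, rfl⟩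
  obtain ⟨bY, hbYdef⟩ : ∃ t : ℝ, t = ((1 - s) * α00 + s * α01) := ⟨_, rfl⟩
  have hone := xchain_one_petal_of hH
  rw [← hgdef] at hg0 hone Ef ⊢
  rw [← hbYdef] at hbY0 hone Ef hBY
  obtain ⟨n, hn⟩ : ∃ n, n = S.card := ⟨_, rfl⟩
  rw [← hn] at hBy hBk hBh hBY ⊢
  have hcardS : S.card = n := hn.symm
  have hu1 : ∀ j ∈ S, ∀ i ∈ (Finset.univ : Finset (Fin 4)), 1 ≤ (![y j / α00, k j / α01, h j / α11, ((1 - s) * y j + s * k j) / bY] : Fin 4 → ℝ) i := by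
    intro j hj i _
    have := hy j hj; have := hyk j hj; have := hg j hj; have := hgk j hj; have := hh j hj
    fin_cases i
    · show 1 ≤ y j / α00; rw [le_div_iff₀ hα00]; linarith only [hy j hj]
    · show 1 ≤ k j / α01; rw [le_div_iff₀ hα01]; linarith only [hg j hj, hgk j hj]
    · show 1 ≤ h j / α11; rw [le_div_iff₀ hα11]; linarith only [hh j hj]
    · show 1 ≤ ((1 - s) * y j + s * k j) / bY
      rw [le_div_iff₀ hbY0, hbYdef]
      have h1 := mul_le_mul_of_nonneg_left (hy j hj) (sub_nonneg.2 hs1.le)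
      have h2 := mul_le_mul_of_nonneg_left (show α01 ≤ k j by linarith only [hg j hj, hgk j hj]) hs0.le
      linarith only [h1, h2]
  have hV0 : ∀ j ∈ S, 0 ≤ (c0 + τ * (1 - σ) * ((1 - s) * y j + s * k j) + s * (1 - τ) * ((1 - σ) * gc j + σ * h j)) / g := fun j hj => by
    apply div_nonneg _ hg0.le
    have hy0 : 0 ≤ y j := hα00.le.trans (hy j hj)
    have hk0 : 0 ≤ k j := hy0.trans (hyk j hj)
    have hπ : 0 ≤ (1 - τ) * (1 - s) * α00 := mul_nonneg (mul_nonneg (sub_nonneg.2 hτ1.le) (sub_nonneg.2 hs1.le)) hα00.le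
    have hc0' : 0 ≤ c0 := le_trans (add_nonneg (mul_nonneg hτ0.le hσ0) hπ) hc0
    have t1 : 0 ≤ τ * (1 - σ) * ((1 - s) * y j + s * k j) :=
      mul_nonneg (mul_nonneg hτ0.le (sub_nonneg.2 hσ1.le)) (add_nonneg (mul_nonneg (sub_nonneg.2 hs1.le) hy0) (mul_nonneg hs0.le hk0))
    have t2 : 0 ≤ s * (1 - τ) * ((1 - σ) * gc j + σ * h j) :=
      mul_nonneg (mul_nonneg hs0.le (sub_nonneg.2 hτ1.le))
        (add_nonneg (mul_nonneg (sub_nonneg.2 hσ1.le) (hα01.le.trans (hg j hj))) (mul_nonneg hσ0 (hα11.le.trans (hh j hj))))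
    exact add_nonneg (add_nonneg hc0' t1) t2
  have hcert' : ∀ j ∈ S, (c0 + τ * (1 - σ) * ((1 - s) * y j + s * k j) + s * (1 - τ) * ((1 - σ) * gc j + σ * h j)) / g ≤
      ∏ i ∈ (Finset.univ : Finset (Fin 4)), ((![y j / α00, k j / α01, h j / α11, ((1 - s) * y j + s * k j) / bY] : Fin 4 → ℝ) i) ^
        ((![ly, lk, lh, lX] : Fin 4 → ℝ) i) := by
    intro j hj
    rw [Fin.prod_univ_four]
    show _ ≤ (y j / α00) ^ ly * (k j / α01) ^ lk * (h j / α11) ^ lh * (((1 - s) * y j + s * k j) / bY) ^ lX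
    rw [div_le_iff₀ hg0]
    have := hone (y j) (k j) (gc j) (h j) (hy j hj) (hyk j hj) (hk1 j hj) (hg j hj) (hgk j hj) (hgh j hj) (hh j hj) (hh1 j hj)
    calc (c0 + τ * (1 - σ) * ((1 - s) * y j + s * k j) + s * (1 - τ) * ((1 - σ) * gc j + σ * h j)) ≤ g * (y j / α00) ^ ly * (k j / α01) ^ lk * (h j / α11) ^ lh * (((1 - s) * y j + s * k j) / bY) ^ lX := this
      _ = (y j / α00) ^ ly * (k j / α01) ^ lk * (h j / α11) ^ lh * (((1 - s) * y j + s * k j) / bY) ^ lX * g := by ring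
  have hn1 : 1 ≤ n := by rw [hn]; exact Finset.card_pos.2 hS
  have hpow : ∀ {b : ℝ}, 0 < b → ∀ {f : κ → ℝ}, ∏ j ∈ S, f j ≤ b ^ (n - 1) → ∏ j ∈ S, f j / b ≤ 1 / b := by
    intro b hb f hU
    rw [Finset.prod_div_distrib, Finset.prod_const, hcardS, div_le_div_iff₀ (pow_pos hb n) hb]
    have e : b ^ n = b ^ (n - 1) * b := by rw [← pow_succ]; congr 1; omega
    rw [e]
    calc (∏ j ∈ S, f j) * b ≤ b ^ (n - 1) * b := mul_le_mul_of_nonneg_right hU hb.le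
      _ = 1 * (b ^ (n - 1) * b) := by ring
  have hbudget : ∀ i ∈ (Finset.univ : Finset (Fin 4)),
      ∏ j ∈ S, (![y j / α00, k j / α01, h j / α11, ((1 - s) * y j + s * k j) / bY] : Fin 4 → ℝ) i ≤ (![1 / α00, 1 / α01, 1 / α11, 1 / bY] : Fin 4 → ℝ) i := by
    intro i _
    fin_cases i
    · show ∏ j ∈ S, y j / α00 ≤ 1 / α00; exact hpow hα00 hBy
    · show ∏ j ∈ S, k j / α01 ≤ 1 / α01; exact hpow hα01 hBk
    · show ∏ j ∈ S, h j / α11 ≤ 1 / α11; exact hpow hα11 hBh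
    · show ∏ j ∈ S, ((1 - s) * y j + s * k j) / bY ≤ 1 / bY; exact hpow hbY0 hBY
  have hlam0 : ∀ i ∈ (Finset.univ : Finset (Fin 4)), 0 ≤ (![ly, lk, lh, lX] : Fin 4 → ℝ) i := by
    intro i _; fin_cases i
    · exact hly
    · exact hlk
    · exact hlh
    · exact hlX
  have hT : ∏ i ∈ (Finset.univ : Finset (Fin 4)), ((![1 / α00, 1 / α01, 1 / α11, 1 / bY] : Fin 4 → ℝ) i) ^ ((![ly, lk, lh, lX] : Fin 4 → ℝ) i) ≤
      (c0 + τ * (1 - σ) * ((1 - s) * 1 + s * 1) + s * (1 - τ) * ((1 - σ) * 1 + σ * 1)) / g := by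
    rw [Fin.prod_univ_four]
    show (1 / α00) ^ ly * (1 / α01) ^ lk * (1 / α11) ^ lh * (1 / bY) ^ lX ≤ _
    rw [le_div_iff₀ hg0, Ef]
    exact le_of_eq (by ring)
  have main := prod_le_of_power_certificate (Finset.univ : Finset (Fin 4)) S
    (fun j => (![y j / α00, k j / α01, h j / α11, ((1 - s) * y j + s * k j) / bY] : Fin 4 → ℝ))
    (fun j => (c0 + τ * (1 - σ) * ((1 - s) * y j + s * k j) + s * (1 - τ) * ((1 - σ) * gc j + σ * h j)) / g)
    (![1 / α00, 1 / α01, 1 / α11, 1 / bY]) (![ly, lk, lh, lX]) ((c0 + τ * (1 - σ) * ((1 - s) * 1 + s * 1) + s * (1 - τ) * ((1 - σ) * 1 + σ * 1)) / g)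
    hlam0 hu1 hV0 hcert' hbudget hT
  clear hcert' hbudget hT hV0 hu1 hlam0 hone hH Eh EH Da Db Dc hbas
  have e1 : ∏ j ∈ S, (c0 + τ * (1 - σ) * ((1 - s) * y j + s * k j) + s * (1 - τ) * ((1 - σ) * gc j + σ * h j)) / g = (∏ j ∈ S, (c0 + τ * (1 - σ) * ((1 - s) * y j + s * k j) + s * (1 - τ) * ((1 - σ) * gc j + σ * h j))) / g ^ n := by
    rw [Finset.prod_div_distrib, Finset.prod_const, hcardS]
  rw [e1, div_le_div_iff₀ (pow_pos hg0 n) hg0] at main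
  have e2 : g ^ n = g ^ (n - 1) * g := by rw [← pow_succ]; congr 1; omega
  rw [e2] at main
  have fin : (∏ j ∈ S, (c0 + τ * (1 - σ) * ((1 - s) * y j + s * k j) + s * (1 - τ) * ((1 - σ) * gc j + σ * h j))) * g ≤ (g ^ (n - 1) * (c0 + τ * (1 - σ) * ((1 - s) * 1 + s * 1) + s * (1 - τ) * ((1 - σ) * 1 + σ * 1))) * g :=
    calc (∏ j ∈ S, (c0 + τ * (1 - σ) * ((1 - s) * y j + s * k j) + s * (1 - τ) * ((1 - σ) * gc j + σ * h j))) * g ≤ (c0 + τ * (1 - σ) * ((1 - s) * 1 + s * 1) + s * (1 - τ) * ((1 - σ) * 1 + σ * 1)) * (g ^ (n - 1) * g) := main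
      _ = (g ^ (n - 1) * (c0 + τ * (1 - σ) * ((1 - s) * 1 + s * 1) + s * (1 - τ) * ((1 - σ) * 1 + σ * 1))) * g := by ring
  exact le_of_mul_le_mul_right fin hg0

end Summit.CriticalPhenomena.PercolationContinuityZ3.Theorems.SunflowerPartition.SafeCalc.LinkedCurrency
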